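/-
Copyright (c) 2026 the pub-hodgecm-mathlib formalisation cell (harness21).  Prover seat hodgecm-mathlib-K2Liu-p09 (g6): Track B «K2-LIT»,
hLiu418 = stmt-HodgeConjecture-24832; LEAD F0P6-plan RULING M-158d «A7-val road (σ)», instance layer I-1b (the partner embedding at the big datum and its blocks).
-/
import Summits.HodgeConjecture.HodgeConjecture.Theorems.K2LiuLocalSWTensorAdaptedBlocks   -- ★ F5c-A (`matA_tensorEmbLoc`, `blk_reindex_kronecker`, `matS_tensorEmbLoc`; brings D-A v1 `tensorEmbLoc`)
import Summits.HodgeConjecture.HodgeConjecture.Theorems.K2LiuOneKronEmbedding           -- ★ I-1a p860311 (`oneKronGLPi`, `oneKronInr`, `commute_kronOneGL_oneKronGLPi`)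
import HarnessLib

/-!
# Crux `HLiu418`, road `K2_Liu`, organ A7-val, instance layer I-1b: THE PARTNER EMBEDDING `U(V′)(L⁺_v) →* U(𝔻 ⊗ V′)(L⁺_v)` AND ITS ADAPTED BLOCKS

Cell `hodgecm-mathlib`, crux item hLiu418 = `stmt-HodgeConjecture-24832`; squad K2 ∕ K2Liu; prover K2Liu-p09 (g6), organ lead A7-val.  DEFINITION LANE
(`--supports stmt-HodgeConjecture-24832 --as helper`): ONE definition with body (`partnerEmbLoc`) + its API; no instance, no notation, no sorry.  The K2Lit CM
datum `(L, e, dV, dW)` doubled to `𝔻`, the auxiliary hermitian frame `dV′ : Fin M₂ → L` (the space `V′`), tensor frames `(eW, e′)` of ★ D-A v1, finite place `v`.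
* §1 **`partnerEmbLoc v : U(diag dV′)(L⁺_v) →* U(𝔻 ⊗ V′)(L⁺_v)`, `g ↦ reindex epsD (1_𝔻 ⊗ₖ g)`** — the second member of the see-saw dual pair
  `U(𝔻) × U(V′) → U(𝔻 ⊗ V′)` at `v` (📤 I-1a `oneKronInr` read on `U(J^{𝔻⊗V′})(L⁺_v)` through ★ `localPi_hermD_tensor_eq`, exactly as ★ `tensorEmbLoc`);
  matrices place by place, continuity, and **`commute_tensorEmbLoc_partnerEmbLoc`**: `(h ⊗ 1)(1 ⊗ g) = (1 ⊗ g)(h ⊗ 1)`.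
* §2 **its adapted matrix**: `matS (1 ⊗ g) = reindex epsD (1 ⊗ₖ G)` and `matA n′ (1 ⊗ g) = reindex (eΣ epsV) (1 ⊗ₖ G)`, `G` the matrix of `g` over `L ⊗ L⁺_v`
  (★ `matS_tensorEmbLoc`'s proof pattern); hence **the adapted blocks `A(1 ⊗ g) = D(1 ⊗ g) = reindex epsV (1_n ⊗ₖ G)`, `B(1 ⊗ g) = C(1 ⊗ g) = 0`**
  (★ `blk_reindex_kronecker` at `M = 1`): `1 ⊗ g` is a BLOCK-DIAGONAL element of `P_{Δ′}` — it stabilises `ℓ_Δ` and `ℓ_∇` — so in ★ β-1's Δ-model it acts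
  LINEARLY by `leviAct (reindex epsV (1 ⊗ₖ G))` (📤 I-0 bridge `exists_deltaTransport_iotaD_eq_leviSp_leviAct`): the `ρ` of ★ V8e.
* §3 the same for `h ⊗ 1` with `h` block-diagonal: all four blocks (★ F5c-A gave `A`, `C`): `B(h ⊗ 1) = reindex epsV (B(h) ⊗ₖ 1)`, `D(h ⊗ 1) = reindex epsV (D(h) ⊗ₖ 1)`.
HONEST LABEL.  `HC_CM` is proved only modulo the 7 printed citations (2 remaining named inputs: hLiu418 = `stmt-HodgeConjecture-24832`,
h413 = `stmt-HodgeConjecture-24833`) until rung 0 closes.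

## References
* [MoeglinVignerasWaldspurger1987] C. Mœglin, M.-F. Vignéras, J.-L. Waldspurger, LNM 1291, Chap. 1 I.17.
* [Kudla1994] S. Kudla, Israel J. Math. 87 (1994), §2 (doubled space, Siegel parabolic), §3.
* [GelbartRogawski1991] S. Gelbart, J. Rogawski, Invent. Math. 105 (1991), §3.2.
-/

set_option autoImplicit false
set_option linter.dupNamespace false -- the mandated namespace repeats `HodgeConjecture.HodgeConjecture`

noncomputable section

open scoped Matrix Kronecker
open NumberField IsDedekindDomain Matrix
open Literature.NumberTheory.Automorphic Literature.NumberTheory.Automorphic.UnitaryGroup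
open Literature.NumberTheory.GelbartRogawski1991 Literature.NumberTheory.GelbartRogawski1991.GRConstruction
open Literature.NumberTheory.GelbartRogawski1991.UnitaryDualPair
open Literature.NumberTheory.GelbartRogawski1991.UnitaryDualPair.LocalSplitting
open Literature.NumberTheory.GelbartRogawski1991.AdaptedBlocks
open Literature.NumberTheory.K2Lit.SiegelDoubled
open Summit.HodgeConjecture.HodgeConjecture.Cruxes.HLiu418.K2LiuLocalSWSectionDefs
open Summit.HodgeConjecture.HodgeConjecture.Cruxes.HLiu418.K2LiuLocalSWTensorAdaptedBlocks
open Summit.HodgeConjecture.HodgeConjecture.Cruxes.HLiu418.K2LiuOneKronEmbedding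

namespace Summit.HodgeConjecture.HodgeConjecture.Cruxes.HLiu418.K2LiuA7ValuePartnerBlocks

variable (L : Type) [Field L] [NumberField L] [IsCMField L]
variable {N M n : ℕ} (e : Fin N × Fin M ≃ Fin n)
  (dV : Fin N → L) (hdV : ∀ i, IsCMField.complexConj L (dV i) = dV i)
  (dW : Fin M → L) (hdW : ∀ i, IsCMField.complexConj L (dW i) = dW i)
variable {M₂ M' n' : ℕ} (eW : Fin M × Fin M₂ ≃ Fin M') (e' : Fin N × Fin M' ≃ Fin n')
  (dV' : Fin M₂ → L) (hdV' : ∀ k, IsCMField.complexConj L (dV' k) = dV' k)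
variable (v : HeightOneSpectrum (𝓞 (Fp L)))

/-! ## §1 The partner embedding `g ↦ 1_𝔻 ⊗ g` -/

/-- **`partnerEmbLoc v : U(diag dV′)(L⁺_v) →* U(𝔻 ⊗ V′)(L⁺_v)`, `g ↦ reindex epsD (1_𝔻 ⊗ₖ g)`** — the `U(V′_v)`-member of the see-saw dual pair at the big
doubled datum (📤 I-1a `oneKronInr` at `e := epsD e eW e'`, `J_V := J^𝔻`, `J_W := diag dV′`, read on `U(J^{𝔻⊗V′})(L⁺_v)` through ★ `localPi_hermD_tensor_eq`).
[cite: MoeglinVignerasWaldspurger1987, Chap. 1 I.17] [cite: Kudla1994, §2 (doubled space, Siegel parabolic)] -/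
def partnerEmbLoc :
    UnitaryGroup.localPi L (IsCMField.complexConj L) M₂ (Matrix.diagonal dV') v →*
      UnitaryGroup.localPi L (IsCMField.complexConj L) (n' + n')
        (hermD L e' dV hdV (tensorFrame L dW eW dV') (tensorFrame_real L dW hdW eW dV' hdV')) v :=
  (MulEquiv.subgroupCongr (localPi_hermD_tensor_eq L e dV hdV dW hdW eW e' dV' hdV' v)).toMonoidHom.comp
    (oneKronInr L (n + n) M₂ (epsD e eW e') (IsCMField.complexConj L) (hermD L e dV hdV dW hdW) (Matrix.diagonal dV') v)

/-- underlying family of `partnerEmbLoc v g`: `oneKronGLPi` of the family of `g`. [cite: MoeglinVignerasWaldspurger1987, Chap. 1 I.17] -/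
theorem coe_partnerEmbLoc (g : UnitaryGroup.localPi L (IsCMField.complexConj L) M₂ (Matrix.diagonal dV') v) :
    ((partnerEmbLoc L e dV hdV dW hdW eW e' dV' hdV' v g :
        UnitaryGroup.localPi L (IsCMField.complexConj L) (n' + n')
          (hermD L e' dV hdV (tensorFrame L dW eW dV') (tensorFrame_real L dW hdW eW dV' hdV')) v) : UnitaryGroup.LocalGLPi L (n' + n') v) =
      oneKronGLPi L (n + n) M₂ (epsD e eW e') v (g : UnitaryGroup.LocalGLPi L M₂ v) :=
  rfl

/-- **the matrix of `(partnerEmbLoc v g)_w` is `reindex epsD epsD (1_𝔻 ⊗ₖ g_w)`**. [cite: Kudla1994, §2 (doubled space, Siegel parabolic)] -/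
theorem coe_partnerEmbLoc_apply (g : UnitaryGroup.localPi L (IsCMField.complexConj L) M₂ (Matrix.diagonal dV') v)
    (w : UnitaryGroup.PlacesOver L v) :
    ((((partnerEmbLoc L e dV hdV dW hdW eW e' dV' hdV' v g :
        UnitaryGroup.localPi L (IsCMField.complexConj L) (n' + n')
          (hermD L e' dV hdV (tensorFrame L dW eW dV') (tensorFrame_real L dW hdW eW dV' hdV')) v) : UnitaryGroup.LocalGLPi L (n' + n') v) w :
        GL (Fin (n' + n')) (w.1.adicCompletion L)) : Matrix (Fin (n' + n')) (Fin (n' + n')) (w.1.adicCompletion L)) =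
      Matrix.reindex (epsD e eW e') (epsD e eW e')
        ((1 : Matrix (Fin (n + n)) (Fin (n + n)) (w.1.adicCompletion L)) ⊗ₖ
          (((g : UnitaryGroup.LocalGLPi L M₂ v) w : GL (Fin M₂) (w.1.adicCompletion L)) : Matrix (Fin M₂) (Fin M₂) (w.1.adicCompletion L))) := by
  rw [coe_partnerEmbLoc]
  exact coe_oneKronGLPi_apply L (n + n) M₂ (epsD e eW e') v (g : UnitaryGroup.LocalGLPi L M₂ v) w

/-- `partnerEmbLoc v` is continuous. [cite: MoeglinVignerasWaldspurger1987, Chap. 1 I.17] -/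
theorem continuous_partnerEmbLoc : Continuous (partnerEmbLoc L e dV hdV dW hdW eW e' dV' hdV' v) := by
  refine Topology.IsInducing.subtypeVal.continuous_iff.2 ?_
  exact ((continuous_oneKronGLPi L (n + n) M₂ (epsD e eW e') v).comp continuous_subtype_val).congr
    fun g => (coe_partnerEmbLoc L e dV hdV dW hdW eW e' dV' hdV' v g).symm

/-- **THE TWO MEMBERS OF THE DUAL PAIR COMMUTE**: `(h ⊗ 1)(1 ⊗ g) = (1 ⊗ g)(h ⊗ 1)` in `U(𝔻 ⊗ V′)(L⁺_v)`. [cite: MoeglinVignerasWaldspurger1987, Chap. 1 I.17] -/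
theorem commute_tensorEmbLoc_partnerEmbLoc (h : UnitaryGroup.localPi L (IsCMField.complexConj L) (n + n) (hermD L e dV hdV dW hdW) v)
    (g : UnitaryGroup.localPi L (IsCMField.complexConj L) M₂ (Matrix.diagonal dV') v) :
    Commute (tensorEmbLoc L e dV hdV dW hdW eW e' dV' hdV' v h) (partnerEmbLoc L e dV hdV dW hdW eW e' dV' hdV' v g) :=
  Subtype.ext (commute_kronOneGL_oneKronGLPi L (n + n) M₂ (epsD e eW e') v (h : UnitaryGroup.LocalGLPi L (n + n) v)
    (g : UnitaryGroup.LocalGLPi L M₂ v)).eq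

/-! ## §2 The adapted matrix and blocks of `1 ⊗ g` -/

/-- **the matrix of `1 ⊗ g` over `Π_{w∣v} L_w` is `reindex epsD epsD (1 ⊗ₖ G)`**, `G` the matrix of `g` over `L ⊗ L⁺_v` (place by place, ★ `matS_map_eval`).
[cite: MoeglinVignerasWaldspurger1987, Chap. 1 I.17] [cite: Kudla1994, §2 (doubled space, Siegel parabolic)] -/
theorem matS_partnerEmbLoc (g : UnitaryGroup.localPi L (IsCMField.complexConj L) M₂ (Matrix.diagonal dV') v) :
    matS (Fp L) L (IsCMField.complexConj L) v n' (partnerEmbLoc L e dV hdV dW hdW eW e' dV' hdV' v g) =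
      Matrix.reindex (epsD e eW e') (epsD e eW e')
        ((1 : Matrix (Fin (n + n)) (Fin (n + n)) (LocalRing L v)) ⊗ₖ ((UnitaryGroup.localGLPiEquiv L M₂ v).symm (g : UnitaryGroup.LocalGLPi L M₂ v)).val) := by
  refine Matrix.ext fun i j => funext fun w => ?_
  have hl := congrFun (congrFun (matS_map_eval (Fp L) L (IsCMField.complexConj L) v n'
    (partnerEmbLoc L e dV hdV dW hdW eW e' dV' hdV' v g) w) i) j
  have hr := fun a b => congrFun (congrFun (GLn.map_piEquiv_symm (fun w'' : UnitaryGroup.PlacesOver L v => w''.1.adicCompletion L) (Fin M₂)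
    (g : UnitaryGroup.LocalGLPi L M₂ v) w) a) b
  simp only [Matrix.map_apply, Pi.evalRingHom_apply] at hl hr
  rw [hl, coe_partnerEmbLoc_apply, Matrix.reindex_apply, Matrix.reindex_apply, Matrix.submatrix_apply, Matrix.submatrix_apply,
    Matrix.kroneckerMap_apply, Matrix.kroneckerMap_apply, Pi.mul_apply, hr, Matrix.one_apply, Matrix.one_apply]
  split_ifs <;> rfl

/-- **THE ADAPTED MATRIX OF `1 ⊗ g`**: `matA n′ (1 ⊗ g) = reindex (eΣ epsV) (eΣ epsV) (1_{n ⊕ n} ⊗ₖ G)` (`epsD = e₂′ ∘ eΣ ∘ (e₂⁻¹ × 1)`, ★ `epsD_inl∕epsD_inr`).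
[cite: Kudla1994, §3] -/
theorem matA_partnerEmbLoc (g : UnitaryGroup.localPi L (IsCMField.complexConj L) M₂ (Matrix.diagonal dV') v) :
    matA (Fp L) L (IsCMField.complexConj L) v n' (partnerEmbLoc L e dV hdV dW hdW eW e' dV' hdV' v g) =
      Matrix.reindex ((Equiv.sumProdDistrib (Fin n) (Fin n) (Fin M₂)).trans ((epsV e eW e').sumCongr (epsV e eW e')))
        ((Equiv.sumProdDistrib (Fin n) (Fin n) (Fin M₂)).trans ((epsV e eW e').sumCongr (epsV e eW e')))
        ((1 : Matrix (Fin n ⊕ Fin n) (Fin n ⊕ Fin n) (LocalRing L v)) ⊗ₖ ((UnitaryGroup.localGLPiEquiv L M₂ v).symm (g : UnitaryGroup.LocalGLPi L M₂ v)).val) := by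
  rw [matA, matS_partnerEmbLoc]
  ext s t
  rcases s with i | i <;> rcases t with j | j <;>
    obtain ⟨⟨x, k⟩, rfl⟩ := (epsV e eW e').surjective i <;> obtain ⟨⟨y, l⟩, rfl⟩ := (epsV e eW e').surjective j <;>
    simp only [Matrix.reindex_apply, Matrix.submatrix_apply, Equiv.symm_symm, Matrix.kroneckerMap_apply, Equiv.symm_trans_apply,
      Equiv.sumCongr_symm, Equiv.sumCongr_apply, Sum.map_inl, Sum.map_inr, Equiv.sumProdDistrib_symm_apply_left,
      Equiv.sumProdDistrib_symm_apply_right, ← epsD_inl, ← epsD_inr, Equiv.symm_apply_apply, Matrix.one_apply, EmbeddingLike.apply_eq_iff_eq]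

/-- **THE ADAPTED BLOCKS OF `1 ⊗ g`**: `A = D = reindex epsV (1_n ⊗ₖ G)`, `B = C = 0` — `1 ⊗ g` is BLOCK-DIAGONAL (it stabilises `ℓ_Δ` and `ℓ_∇`).
[cite: Kudla1994, §3] [cite: MoeglinVignerasWaldspurger1987, Chap. 2 II.6] -/
theorem blk_matA_partnerEmbLoc (g : UnitaryGroup.localPi L (IsCMField.complexConj L) M₂ (Matrix.diagonal dV') v) :
    blkA (matA (Fp L) L (IsCMField.complexConj L) v n' (partnerEmbLoc L e dV hdV dW hdW eW e' dV' hdV' v g)) =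
        Matrix.reindex (epsV e eW e') (epsV e eW e')
          ((1 : Matrix (Fin n) (Fin n) (LocalRing L v)) ⊗ₖ ((UnitaryGroup.localGLPiEquiv L M₂ v).symm (g : UnitaryGroup.LocalGLPi L M₂ v)).val) ∧
      blkB (matA (Fp L) L (IsCMField.complexConj L) v n' (partnerEmbLoc L e dV hdV dW hdW eW e' dV' hdV' v g)) = 0 ∧
      blkC (matA (Fp L) L (IsCMField.complexConj L) v n' (partnerEmbLoc L e dV hdV dW hdW eW e' dV' hdV' v g)) = 0 ∧
      blkD (matA (Fp L) L (IsCMField.complexConj L) v n' (partnerEmbLoc L e dV hdV dW hdW eW e' dV' hdV' v g)) =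
        Matrix.reindex (epsV e eW e') (epsV e eW e')
          ((1 : Matrix (Fin n) (Fin n) (LocalRing L v)) ⊗ₖ ((UnitaryGroup.localGLPiEquiv L M₂ v).symm (g : UnitaryGroup.LocalGLPi L M₂ v)).val) := by
  obtain ⟨hA, hB, hC, hD⟩ := blk_reindex_kronecker (epsV e eW e') (1 : Matrix (Fin n ⊕ Fin n) (Fin n ⊕ Fin n) (LocalRing L v))
    ((UnitaryGroup.localGLPiEquiv L M₂ v).symm (g : UnitaryGroup.LocalGLPi L M₂ v)).val
  rw [matA_partnerEmbLoc, hA, hB, hC, hD, blkA_one, blkB_one, blkC_one, blkD_one]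
  refine ⟨rfl, ?_, ?_, rfl⟩ <;>
  · rw [Matrix.reindex_apply, Matrix.zero_kronecker, Matrix.submatrix_zero]
    rfl

/-! ## §3 All four adapted blocks of `h ⊗ 1` -/

/-- **the adapted blocks `B` and `D` of `h ⊗ 1`**: `B(h ⊗ 1) = reindex epsV (B(h) ⊗ₖ 1)`, `D(h ⊗ 1) = reindex epsV (D(h) ⊗ₖ 1)` (★ F5c-A `blk_matA_tensorEmbLoc` gave `A`, `C`).
In particular `h ⊗ 1` is block-diagonal when `h` is. [cite: Kudla1994, §3] -/
theorem blkBD_matA_tensorEmbLoc (h : UnitaryGroup.localPi L (IsCMField.complexConj L) (n + n) (hermD L e dV hdV dW hdW) v) :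
    blkB (matA (Fp L) L (IsCMField.complexConj L) v n' (tensorEmbLoc L e dV hdV dW hdW eW e' dV' hdV' v h)) =
        Matrix.reindex (epsV e eW e') (epsV e eW e')
          (blkB (matA (Fp L) L (IsCMField.complexConj L) v n h) ⊗ₖ (1 : Matrix (Fin M₂) (Fin M₂) (LocalRing L v))) ∧
      blkD (matA (Fp L) L (IsCMField.complexConj L) v n' (tensorEmbLoc L e dV hdV dW hdW eW e' dV' hdV' v h)) =
        Matrix.reindex (epsV e eW e') (epsV e eW e')
          (blkD (matA (Fp L) L (IsCMField.complexConj L) v n h) ⊗ₖ (1 : Matrix (Fin M₂) (Fin M₂) (LocalRing L v))) := by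
  obtain ⟨-, hB, -, hD⟩ := blk_reindex_kronecker (epsV e eW e') (matA (Fp L) L (IsCMField.complexConj L) v n h)
    (1 : Matrix (Fin M₂) (Fin M₂) (LocalRing L v))
  rw [matA_tensorEmbLoc]
  exact ⟨hB, hD⟩

/-- `B(h ⊗ 1) = 0` when `B(h) = 0`. [cite: Kudla1994, §3] -/
theorem blkB_matA_tensorEmbLoc_eq_zero {h : UnitaryGroup.localPi L (IsCMField.complexConj L) (n + n) (hermD L e dV hdV dW hdW) v}
    (hB : blkB (matA (Fp L) L (IsCMField.complexConj L) v n h) = 0) :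
    blkB (matA (Fp L) L (IsCMField.complexConj L) v n' (tensorEmbLoc L e dV hdV dW hdW eW e' dV' hdV' v h)) = 0 := by
  rw [(blkBD_matA_tensorEmbLoc L e dV hdV dW hdW eW e' dV' hdV' v h).1, hB, Matrix.reindex_apply, Matrix.zero_kronecker, Matrix.submatrix_zero]
  rfl

/-- `C(h ⊗ 1) = 0` when `C(h) = 0` (`P_Δ ↦ P_{Δ′}`, cf. ★ `isSiegelDelta_tensorEmbLoc`). [cite: Kudla1994, §3] -/
theorem blkC_matA_tensorEmbLoc_eq_zero {h : UnitaryGroup.localPi L (IsCMField.complexConj L) (n + n) (hermD L e dV hdV dW hdW) v}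
    (hC : blkC (matA (Fp L) L (IsCMField.complexConj L) v n h) = 0) :
    blkC (matA (Fp L) L (IsCMField.complexConj L) v n' (tensorEmbLoc L e dV hdV dW hdW eW e' dV' hdV' v h)) = 0 := by
  rw [(blk_matA_tensorEmbLoc L e dV hdV dW hdW eW e' dV' hdV' v h).2, hC, Matrix.reindex_apply, Matrix.zero_kronecker, Matrix.submatrix_zero]
  rfl

end Summit.HodgeConjecture.HodgeConjecture.Cruxes.HLiu418.K2LiuA7ValuePartnerBlocks

end
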